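import Literature.NumberTheory.EllipticCurves.BertoliniDarmonPrasanna2013.WaldspurgerCMSquareFormula
import HarnessLib

/-!
# Bertolini–Darmon–Prasanna 2013: the Shimura–Maass operator (1.2.9)/(4.2.1) and the two printed
# ingredients of (5.1.16) SEPARATELY — Thm. 5.4 (5.1.12) as an identity at the Heegner points of `ℍ`,
# and Prop. 1.12 (1) = Shimura 1975 (algebraicity of the Shimura–Maass derivatives at CM points)

Trunk T-NT-EC (`Literature/NumberTheory/EllipticCurves`), story `BertoliniDarmonPrasanna2013/` (Duke Math. J. 162
(2013); bib key `BertoliniDarmonPrasanna2013`; author version `paper:url-39cfb2a03b1d`, glyph text of record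
`run/shared/lean/pub/bsd-eis/lit/src/bdp13-author/`, read by this seat on pp. 8–9 ((1.2.2), (1.2.9), Lemma 1.5),
14 (Prop. 1.12), 34 ((4.1.1)–(4.1.4)), 38 (Thm. 4.6), 40 ((4.2.1)), 58 (Lemma 5.2, (5.1.11)), 59 ((5.1.12),
(5.1.15)), 60 (Thm. 5.5, (5.1.16))). Sequel of `WaldspurgerCMSquareFormula.lean` (the fact
`thm54_bdpLalg_eq_sq_sum_cmValues` = (5.1.16)'s SHAPE with `χ`-free coefficients in `H(i)`): this file ATOMISES that
fact into its two printed ingredients, now stating the CM values as DEFINED objects — the iterated Shimura–Maass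
derivatives of `f` at the Heegner points `τ_Q ∈ ℍ` of the tree (`heegnerTau`, `heegnerForms N d_K` of
`HeegnerPoints.lean`). TWO definitions with a body (the operator (1.2.9) and its iterate), TWO named facts
(D-0014/D-0026 accounting: +2), no `sorry`, no instance, no notation. Cell `bsd-stepL`, seat `bsd-stepL-desc3-p1x`;
consumer: `Summits/BirchSwinnertonDyer/BirchSwinnertonDyer/Theorems/ClassRecordThreeOpenValueReciprocityOfWaldspurgerAtoms.lean`,
which PROVES `thm54_heegnerPoints → prop112_shimura_heegnerPoints → thm54_bdpLalg_eq_sq_sum_cmValues` (and hence the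
reciprocity chain of `ClassRecordThreeOpenValueReciprocityOfWaldspurger.lean` from these two atoms).

## The printed statements (verbatim, glyph text of record)

* **(1.2.2)** (p. 8). "`f(τ) := f(ℂ/⟨1, τ⟩, 1/N, 2πi dw)`, where `w` is the standard coordinate on `ℂ/⟨1, τ⟩`";
  (4.1.1) "`f(⟨1,τ⟩, 1/N) = f(τ)`, for all `τ ∈ ℍ`"; (4.1.2) "`f(λL, λt) = λ^{−k} f(L,t)`, for all `λ ∈ ℂ^×`".
* **(1.2.9)** (p. 9) = **(4.2.1)** (p. 40). "`δ_k f(τ) := (1/(2πi))·(∂/∂τ + k/(τ − τ̄)) f(τ)`, which maps real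
  analytic modular forms of weight `k` to real analytic modular forms of weight `k + 2`"; (p. 9) "`δ^j_r :=
  δ_{r+2j−2} ∘ ⋯ ∘ δ_r` is the `j`-th iterate of the Shimura–Maass derivative"; **Lemma 1.5** (1.2.10):
  "`Θ_Hodge f = δ_r f`" for nearly holomorphic `f`.
* **Theorem 5.4** (5.1.12) (p. 59). "`C(f,χ,c)·L(f,χ⁻¹,0) = w(f,χ)·(∑_{[𝔞]∈Pic(𝒪_c)} χ_j⁻¹(𝔞)·δ^j_k f(𝔞 ∗ (A₀, t,
  2πi dw)))²`", `A₀ = ℂ/𝒪_c`, `χ_j = χN^j`, the constants of Thm. 4.6 and (5.1.11) — typed by bsd-eis as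
  `bdpConstC`, `bdpConstW`, so that `w(f,χ)⁻¹C(f,χ,1)L(f,χ⁻¹,0) = bdpLalg f #S(f) w_f 𝔟 N b_N 1 φ n` (period `Ω = 1`).
* **Lemma 5.2 / (4.1.4)** (pp. 34, 58). "`w_N(f) = w_f f^ρ`", "`Λ(f,s) = w_f Λ(f^ρ, k − s)`", "`|w_f| = 1` since
  `w_N² = 1`": for the rational newform `f = f^ρ` on `Γ₀(N)` (`ε_f = 𝟙`, so (4.1.3) removes the dependence on the
  root of unity `ζ` of (5.1.8)), `w_f` is the sign of the functional equation, `w_f = ±1`.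
* **Proposition 1.12 (1)** (p. 14; "Part (1) is due to Shimura [Shim1]" = Shimura 1975). "Let `(A′,t′,ω′)/F` be a
  marked elliptic curve with complex multiplication by an order in `K`. … (1) The complex number
  `Θ_Hodge f(A′,t′,ω′)` belongs to `ι_∞(F)`" (for `f ∈ M_k(Γ, F)`); **(5.1.15)** (p. 59) "`ω₀ = Ω · 2πi dw`".

## What is typed

* `maassShimuraRaise k F z = (1/(2πi))·(∂F/∂z(z) + k/(z − z̄)·F(z))` for `F : ℂ → ℂ`, `∂/∂z = ½(∂_x − i∂_y)` written
  with Mathlib's real Fréchet derivative (`fderiv ℝ F z 1`, `fderiv ℝ F z i`; = the tree's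
  `Literature.Analysis.Complex.delAlong 1`, not imported to keep the closure small); `maassShimuraIter k j` the iterate
  `δ_{k+2j−2} ∘ ⋯ ∘ δ_k` ((1.2.9)); a cusp form `f` is read on `ℂ` as `z ↦ f(UpperHalfPlane.ofComplex z)` (= `f` on
  `ℍ`, junk off `ℍ`; derivatives at points of the open set `ℍ` see only values on `ℍ`).
* `thm54_bdpLalg_eq_sq_sum_heegnerPoints` — (5.1.12) READ AT THE HEEGNER POINTS: the marked curve `𝔞 ∗ (A₀, t, 2πi dw)`
  is `(ℂ/Λ, t', 2πi dw)` with `Λ = 𝔞⁻¹`-type lattice `= c·⟨1, τ⟩`, `c ∈ K^×`, `τ = τ_Q ∈ ℍ ∩ K` a Heegner point of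
  level `N` for `𝒪_K` (`Q ∈ heegnerForms N d_K`: Gross 1984 §I.1 = the tree's dictionary
  `exists_heegnerForm_mk0_formIdeal_eq`), so by (1.2.2) and (4.1.2) `δ^j_k f(𝔞 ∗ (A₀,t,2πi dw)) = c^{−(k+2j)}·(δ^j_k f)(τ_Q)`.
  Typed, for every `n ≥ 1`: a finite family `(𝔞_i, Q_i ∈ heegnerForms N d_K, a_i ∈ e(K)^×)` with
  `bdpLalg f sf w_f 𝔟 N b_N 1 φ n = κ^{4n}·(∑_i χ_j(𝔞_i)⁻¹·a_i·(δ_2^{n−1} f)(τ_{Q_i}))²` for every unramified `φ` of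
  type `(n,−n)`; `κ ∈ ℂ^×` is an ∃-quantified normalisation of the dictionary "rule on triples ↔ function on `ℍ`"
  (`κ = 1` under (1.2.2); the statement with `∃ κ` is weaker), `w_f ∈ {1, −1}`, `b_N = e(x)` for some `x ∈ K`, `𝔟 ≠ 0`.
* `prop112_shimura_maassShimuraIter_heegnerTau_mem` — Prop. 1.12 (1) READ AT THE HEEGNER POINTS: ONE period `Ω ≠ 0`
  ((5.1.15), of `(A₀, ω₀)`) and ONE field `F₀ ⊂ ℂ` (= `H(i)`, with the properties listed in the sister fact:
  finite, `⊇ K`, `∋ i`, unramified above every odd prime split in `K`) such that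
  `(δ_2^j f)(τ_Q)/Ω^{2+2j} ∈ F₀` for EVERY `j ≥ 0` and EVERY `Q ∈ heegnerForms N d_K`. Why print gives this, uniformly:
  `(δ^j f)(τ_Q) = c_Q^{−(k+2j)}·δ^j f(ℂ/𝔞_Q, t, 2πi dw)` (`c_Q ∈ ℚ^×`: `⟨1,τ_Q⟩ = A⁻¹·𝔞_Q`), the isogeny
  `ℂ/𝔞_Q → ℂ/𝒪_K = A₀` (identity on `ℂ`) is defined over `H` and pulls `ω₀ = Ω·2πi dw` back to `λ_Q·ω_{Q,alg}` with
  `λ_Q ∈ H^×` for an `H`-rational differential `ω_{Q,alg}` on the `H`-model of `ℂ/𝔞_Q`, so `2πi dw = Ω⁻¹λ_Q ω_{Q,alg}`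
  on `ℂ/𝔞_Q` and `δ^j f(ℂ/𝔞_Q, t, 2πi dw) = (Ω/λ_Q)^{k+2j}·Θ^j_Hodge f(ℂ/𝔞_Q, t, ω_{Q,alg})` (Lemma 1.5, (4.1.2)),
  the last value lying in `H' K_f` by Prop. 1.12 (1) and in `H̃_1 K_f = H` by (4.1.3) with `ε_f = 𝟙` (as in Thm.
  5.5's own field `F ⊇ H̃_c`): altogether `(δ^j f)(τ_Q)/Ω^{k+2j} = c_Q^{−(k+2j)}λ_Q^{−(k+2j)}·Θ^j_Hodge f(…) ∈ H`.
  (Shimura 1975, Main Theorem: `δ^j_k f(τ)/Ω_K^{k+2j} ∈ ℚ̄` for every CM point `τ ∈ K ∩ ℍ` and every `f` with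
  algebraic Fourier coefficients — the coarse form; the field is the refinement just explained.)

TOGETHER the two facts imply `thm54_bdpLalg_eq_sq_sum_cmValues` (consumer file: `V_i := a_i·(δ_2^{n−1}f)(τ_{Q_i})/Ω^{2n}`
with the period `κ·Ω`), so they REPLACE it in the trust base by two atoms, each a famous statement read at defined
objects: an ANALYTIC identity (explicit Waldspurger at Heegner points — numerically testable term by term) and
Shimura's algebraicity theorem. NOT typed, NOT asserted: Lemma 1.5 / nearly-holomorphic theory; that `κ = 1`; the
identification of the family with `Pic(𝒪_K)`; anything at `c > 1`, `k > 2`, `ε_f ≠ 𝟙`, even `d_K`.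

## References

* [BertoliniDarmonPrasanna2013] (1.2.2), (1.2.9), Lemma 1.5 (pp. 8–9); Prop. 1.12 (1) (p. 14); (4.1.1)–(4.1.4)
  (p. 34); Thm. 4.6 (p. 38); (4.2.1) (p. 40); Lemma 5.2, (5.1.11) (p. 58); Thm. 5.4 (5.1.12), (5.1.15) (p. 59);
  Thm. 5.5, (5.1.16) (p. 60).
* [Shimura1975Arith] G. Shimura, Ann. of Math. 102 (1975), Main Theorem (= [Shim1] of BDP).
* [Gross1984] B. Gross, *Heegner points on X₀(N)*, §I.1 (Heegner points ↔ `(𝒪, 𝔫, [𝔞])`).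
* [Cox2013] Thm. 8.10 / §9.A (`H/K` unramified; isogenies of CM curves over `H`).
-/

noncomputable section

open scoped NumberField
open NumberField IsDedekindDomain
open Literature.NumberTheory.GaloisRepresentations
open Literature.NumberTheory.EllipticCurves.ModularForms

namespace Literature.NumberTheory.EllipticCurves.BertoliniDarmonPrasanna2013

/-! ### §1 The Shimura–Maass operator (definitions with a body) -/

section Operator

/-- **BDP 2013 (1.2.9) = (4.2.1): the weight-`k` Shimura–Maass raising operator** on functions `F : ℂ → ℂ`:
`δ_k F(z) = (1/(2πi))·(∂F/∂z(z) + k/(z − z̄)·F(z))`, with the Wirtinger derivative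
`∂/∂z = ½(∂/∂x − i ∂/∂y)` expressed through the real Fréchet derivative (`fderiv ℝ F z 1 = ∂F/∂x`,
`fderiv ℝ F z i = ∂F/∂y`; junk `0` where `F` is not real-differentiable, by Mathlib's convention for `fderiv`).
"maps real analytic modular forms of weight `k` to real analytic modular forms of weight `k + 2`".
[cite: BertoliniDarmonPrasanna2013, (1.2.9) (p. 9) and (4.2.1) (p. 40)] -/
def maassShimuraRaise (k : ℤ) (F : ℂ → ℂ) (z : ℂ) : ℂ :=
  (1 / (2 * (Real.pi : ℂ) * Complex.I)) *
    ((2 : ℂ)⁻¹ * (fderiv ℝ F z 1 - Complex.I * fderiv ℝ F z Complex.I) +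
      (k : ℂ) / (z - (starRingEnd ℂ) z) * F z)

/-- **BDP 2013, p. 9 (after (1.2.10)): the `j`-th iterate `δ^j_k := δ_{k+2j−2} ∘ ⋯ ∘ δ_k`** of the Shimura–Maass
operator (`δ^0_k = id`, `δ^{j+1}_k = δ_{k+2j} ∘ δ^j_k`), "sending nearly holomorphic modular forms of weight `r` to
nearly holomorphic modular forms of weight `r + 2j`". [cite: BertoliniDarmonPrasanna2013, (1.2.9)–(1.2.10) (p. 9)] -/
def maassShimuraIter (k : ℤ) : ℕ → (ℂ → ℂ) → ℂ → ℂ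
  | 0, F => F
  | j + 1, F => maassShimuraRaise (k + 2 * (j : ℤ)) (maassShimuraIter k j F)

/-- `δ^0_k F = F`. [cite: BertoliniDarmonPrasanna2013, (1.2.9) (p. 9)] -/
theorem maassShimuraIter_zero (k : ℤ) (F : ℂ → ℂ) : maassShimuraIter k 0 F = F := rfl

/-- `δ^{j+1}_k F = δ_{k+2j}(δ^j_k F)`. [cite: BertoliniDarmonPrasanna2013, (1.2.9)–(1.2.10) (p. 9)] -/
theorem maassShimuraIter_succ (k : ℤ) (j : ℕ) (F : ℂ → ℂ) :
    maassShimuraIter k (j + 1) F = maassShimuraRaise (k + 2 * (j : ℤ)) (maassShimuraIter k j F) := rfl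

end Operator

/-! ### §2 The two printed ingredients of (5.1.16), read at the Heegner points (named facts) -/

section Facts

/-- **Bertolini–Darmon–Prasanna 2013, Thm. 5.4 (5.1.12), at weight `2`, conductor `1`, read at the Heegner points
of `ℍ` through (1.2.2)/(4.1.2): the explicit Waldspurger formula as an ANALYTIC identity.** For the newform `f` of
level `N = N_W` of an elliptic curve `W/ℚ` and an imaginary quadratic `K` of ODD discriminant in which every prime
dividing `N` splits, there are the sign `w_f = ±1` (Lemma 5.2/(4.1.4): the root number), `b_N = e(x) ≠ 0` with
`x ∈ K` and an ideal `𝔟 ≠ 0` ((5.1.6)), the exponent `#S(f)`, and a normalisation `κ ∈ ℂ^×` of the dictionary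
"modular form as a rule on marked curves ↔ function on `ℍ`" (`κ = 1` under (1.2.2)), such that for every `n ≥ 1`
there are finitely many triples `(𝔞_i, Q_i, a_i)` — an integral ideal, a Heegner form `Q_i ∈ heegnerForms N d_K`
(its Heegner point `τ_{Q_i} = heegnerTau Q_i ∈ ℍ ∩ K`), and a scalar `a_i = e(y_i)`, `y_i ∈ K^×` (in print: `𝔞`
over `Pic(𝒪_K)`, `τ` the CM point of `𝔞 ∗ (A₀, t)`, `a = c^{−2n}` for the lattice scalar `c ∈ K^×`) — with, for
every everywhere-unramified Hecke character `φ` of `K` of infinity type `(n, −n)` (`χ = φ𝐍_K`, `χ_j(𝔞) = φ(𝔞)N𝔞^n`):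

  `w(f,χ)⁻¹·C(f,χ,1)·L(f,χ⁻¹,0) = κ^{4n} · (∑_i χ_j(𝔞_i)⁻¹ · a_i · (δ_2^{n−1} f)(τ_{Q_i}))²`,

the left side being `bdpLalg f #S(f) w_f 𝔟 N b_N 1 φ n` (the sister module's `L_alg` at period `1`) and `δ` the
operator `maassShimuraIter 2 (n−1)` applied to `z ↦ f(UpperHalfPlane.ofComplex z)`. ∃-weakened reading of the
printed identity; a `Prop`, NOT asserted. -- TODO(general form): weight `k`, `ε_f`, conductor `c`, the family = `Pic(𝒪_c)`.
[cite: BertoliniDarmonPrasanna2013, Thm. 5.4 (5.1.12) (p. 59), with (1.2.2) (p. 8), (1.2.9) (p. 9), (4.1.2)–(4.1.4) (p. 34), Lemma 5.2 and (5.1.11) (p. 58)]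
[cite: Gross1984, §I.1 (Heegner points of level N as classes of proper ideals)] -/
def thm54_bdpLalg_eq_sq_sum_heegnerPoints : Prop :=
  ∀ (W : WeierstrassCurve ℚ) [W.IsElliptic] (K : Type) [Field K] [NumberField K] {N : ℕ} [NeZero N]
    (f : CuspForm (CongruenceSubgroup.Gamma0 N) 2),
    IsNewformOf W f → W.conductorNorm ℤ = N → IsImaginaryQuadratic K → Odd (NumberField.discr K) →
    SatisfiesHeegnerHypothesis N K →
    ∃ (κ wf bN : ℂ) (𝔟 : Ideal (𝓞 K)) (sf : ℕ),
      κ ≠ 0 ∧ (wf = 1 ∨ wf = -1) ∧ bN ≠ 0 ∧ (∃ (e : K →+* ℂ) (x : K), e x = bN) ∧ 𝔟 ≠ ⊥ ∧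
      ∀ n : ℕ, 0 < n →
        ∃ (A : Finset (Ideal (𝓞 K) × (ℤ × ℤ × ℤ))) (a : Ideal (𝓞 K) × (ℤ × ℤ × ℤ) → ℂ),
          (∀ i ∈ A, i.2 ∈ heegnerForms N (NumberField.discr K) ∧ a i ≠ 0 ∧
            ∃ (e : K →+* ℂ) (y : K), e y = a i) ∧
          ∀ (φ : HeckeCharacter K), (∀ v : HeightOneSpectrum (𝓞 K), φ.IsUnramifiedAt v) →
            φ.HasInfinityType (fun _ ↦ (n : ℤ)) (fun _ ↦ -(n : ℤ)) →
            bdpLalg f sf wf 𝔟 N bN 1 φ n =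
              κ ^ (4 * n) *
                (∑ i ∈ A, (heckeIdealValueExtZero φ i.1 * ((Ideal.absNorm i.1 : ℕ) : ℂ) ^ n)⁻¹ * a i *
                  maassShimuraIter 2 (n - 1) (fun z ↦ f (UpperHalfPlane.ofComplex z))
                    ((heegnerTau i.2 : UpperHalfPlane) : ℂ)) ^ 2

/-- **Bertolini–Darmon–Prasanna 2013, Prop. 1.12 (1) (= Shimura 1975) with Lemma 1.5, (5.1.15), (4.1.2)–(4.1.3),
read at the Heegner points of `ℍ`: algebraicity of the Shimura–Maass derivatives of `f` at the CM points of level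
`N`, with ONE period and ONE field.** For `f`, `K`, `N` as in the sister fact there are a period `Ω ≠ 0` ((5.1.15),
of `(A₀, ω₀)`) and a subfield `F₀ ⊂ ℂ` finite over `ℚ` — the Hilbert class field of `K` with `i` adjoined, as in
`thm54_bdpLalg_eq_sq_sum_cmValues` (module docstring: why the field is `H`, uniformly in `j` and `Q`) — containing
`K` and `i` and unramified above every odd rational prime split in `K`, such that for EVERY `j ≥ 0` and EVERY
Heegner form `Q ∈ heegnerForms N d_K`:

  `(δ_2^j f)(τ_Q) / Ω^{2+2j} ∈ F₀`.

(Shimura's Main Theorem gives `∈ ℚ̄`; the field `H ∋` these values by Prop. 1.12 (1) on the `H`-models of the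
curves `ℂ/𝔞_Q` and the `H`-rationality of the isogenies and differentials relating them to `(A₀, ω₀)`.) A `Prop`,
NOT asserted. -- TODO(general form): any `f ∈ M_k(Γ, ℚ̄)` and any CM point `τ ∈ K ∩ ℍ` (Shimura), with the
reciprocity law describing `Gal(ℚ̄/K)` on the values.
[cite: BertoliniDarmonPrasanna2013, Prop. 1.12 (1) (p. 14), Lemma 1.5 (p. 9), (4.1.2)–(4.1.3) (p. 34), (5.1.15) (p. 59)]
[cite: Shimura1975Arith, Main Theorem (values of Shimura–Maass derivatives of arithmetic modular forms at CM points)]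
[cite: Cox2013, Thm. 8.10 and §9.A (H/K unramified)] -/
def prop112_shimura_maassShimuraIter_heegnerTau_mem : Prop :=
  ∀ (W : WeierstrassCurve ℚ) [W.IsElliptic] (K : Type) [Field K] [NumberField K] {N : ℕ} [NeZero N]
    (f : CuspForm (CongruenceSubgroup.Gamma0 N) 2),
    IsNewformOf W f → W.conductorNorm ℤ = N → IsImaginaryQuadratic K → Odd (NumberField.discr K) →
    SatisfiesHeegnerHypothesis N K →
    ∃ (Ω : ℂ) (F : IntermediateField ℚ ℂ),
      Ω ≠ 0 ∧ FiniteDimensional ℚ F ∧ (∀ (e : K →+* ℂ) (k : K), e k ∈ F) ∧ Complex.I ∈ F ∧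
      (∀ ℓ : ℕ, ℓ.Prime → ℓ ≠ 2 → ((Ideal.span {(ℓ : ℤ)}).primesOver (𝓞 K)).ncard = 2 →
        ∀ P : Ideal (𝓞 F), P.IsPrime → ((ℓ : ℕ) : 𝓞 F) ∈ P → P.ramificationIdx (𝓞 ℚ) = 1) ∧
      ∀ (j : ℕ) (Q : ℤ × ℤ × ℤ), Q ∈ heegnerForms N (NumberField.discr K) →
        maassShimuraIter 2 j (fun z ↦ f (UpperHalfPlane.ofComplex z))
            ((heegnerTau Q : UpperHalfPlane) : ℂ) / Ω ^ (2 + 2 * j) ∈ F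

end Facts

end Literature.NumberTheory.EllipticCurves.BertoliniDarmonPrasanna2013

end
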